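import Literature.AnabelianGeometry.EtaleTheta.Discharge.Sec4Prop42SubZetaA
import Literature.AnabelianGeometry.EtaleTheta.Discharge.Sec4Prop42SubZetaBLawFree
import HarnessLib

/-!
# [EtTh] Prop. 4.2 (iv): L06 `ZetaA` ⇐ L05 `UnitRootsUpstairs`, and (iv) AS TYPED ⇐ L05, for EVERY §4 setting
# with NO structural law (the «`Φ` divisorial» hypothesis of the theorems of record removed)

Mochizuki, *The étale theta function and its Frobenioid-theoretic manifestations*, Publ. RIMS **45**
(2009) [EtTh], §4, Proposition 4.2 (iv), statement PDF p.89 L1–12, proof p.90 L12–24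
[cite: MochizukiEtTh2009, Prop 4.2 p.89]; setting of §4, PDF p.86 («whose divisor monoid `Φ` is perfect»);
Definition 4.1 (iv) p.87.

PROOF-ONLY companion (abc-iut cell, block F, seat abc-iut-f-084; FACT-LIST rows F-2799 `ZetaA` /
F-2798 `UnitRootsUpstairs` of the sub-DAG statements file `Prop42Sub.lean`, abc-iut-w5-d134 — their
CONDITIONAL instance forms, not their universal closures, which are abc-iut-f-130's).  Nothing of
`Prop42Sub.lean`, `BiKummer.lean`, `BiKummerRoots.lean` (abc-iut-L2-t3), of abc-iut-w4-d044's theorem of record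
`Discharge/Sec4Prop42SubZetaA.lean` (`zetaA_of_unitRootsUpstairs`, modulo `hΦd` «`Φ` divisorial» and `hBg`),
of abc-iut-f-131's `Sec4Prop42SubIvHolds.lean` / `Sec4Prop42SubIvOfZetaA.lean` or of layer L1's [FrdI]
Thm. 5.2 files is edited or restated; no `def`, no named fact, no instance, no new hypothesis.

WHAT IS PROVED.  `zetaA_of_unitRootsUpstairs_lawFree`: for EVERY setting `S : BiKummerSetting X T D VD`
(every opaque [FrdI] vocabulary) whose Def. 4.1 (iv)(e) predicate implies the canonical reading (`hE`, as in
the theorem of record; definitional at `mkOfModelCanonical`) and every transport, L05 ⟹ L06 — WITHOUT the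
[FrdI] Thm. 5.2 (ii) laws.  abc-iut-w4-d044's proof is followed verbatim (naturality of the Frobenius
sections along `α'`; `F̄(n̄)_{A_⊙} = F(n)_{A_⊙} ≫ x` for a unit `x`; the lift `ζ₀` of `Ā'` through the
pull-back morphism `ᾱ'`; the unit `y` over `x⁻¹`; L05: `y = t^N`; Frobenius-normalization; `ζ_A := t ≫ ζ₀`);
the law «`Φ` divisorial» entered it at three bookkeeping points only, each of which holds law-free here:
* `deg_Fr(α') = 1` for the pull-back part `α'` — [FrdI] Thm. 5.2 (ii)'s test-object argument
  (`degFr_eq_one_of_isPullback`, the tree's `ModelFrobenioid.degFr_div_of_isPullbackMorphism` minus its last,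
  sharpness, step);
* `Div(α') = 0` — NOT from "pull-back morphisms have `Div = 0`" (false over a non-sharp `Φ`) but from
  Def. 4.1 (iv) itself: `α = α'' ≫ α'` is an ISOMETRY and `α''` is base-identity of Frobenius type, hence an
  isometry, so `0 = Div(α) = Div(α') + deg_Fr(α')·Div(α'') = Div(α')` (`div_α₁_eq_one`);
* `Div(x) = 0` for the unit `x` with `F(n)_{A_⊙} ≫ x = F̄(n̄)_{A_⊙}` — both Frobenius endomorphisms are
  isometries (`div_iso_eq_one_of_comp_eq`), and then `Div(x⁻¹) = 0`.
`B` group-like is the structure field `isUnit_BΛ`.  CONSEQUENCE `prop42_iv_of_unitRootsUpstairs_lawFree`: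
**[EtTh] Prop. 4.2 (iv) AS TYPED ⇐ L05 `UnitRootsUpstairs` + `hE`, for EVERY setting and every transport,
with NO structural law and no birational dictionary** (L06 here, L07 = `zetaB_lawFree` (abc-iut-f-084,
p436714), L08 = abc-iut-f-131's `betaCompat_holds`); at `mkOfModelCanonical`: `… _mkOfModelCanonical_lawFree`
(`hE` definitional) — the sub-DAG's route to the typed node (iv) is open EXACTLY modulo L05, i.e. the
roots-of-constants law at the free `(N, H)`-slot (GAP-LEDGER G-w4d044-1), for every setting.

HONEST FRAMING: refereed pre-IUT material ([EtTh] 2009, [FrdI] 2008); intermediate statements OF THE PRINTED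
PROOF as typed by the cell; typed ≠ proved for L05; a FACT row is an assumption label; nothing here bears on
or takes a side on [IUTchIII] Cor. 3.12.
-/

namespace Literature.AnabelianGeometry.EtaleTheta

open CategoryTheory Opposite Literature.AlgebraicGeometry.Frobenioids

universe u₀ v₀ u v w

variable {K : Type u₀} [Field K]

namespace BiKummerSetting

variable {X : SemiGraphs.TemperedArithmeticGroup.{u₀} K} {D₀ : Type u₀} [Category.{v₀} D₀]
  {V : FrdIMonoidStub.{w}} {T : RealifiedDivisorMonoids (D₀ := D₀) V} {D : Type u} [Category.{v} D]
  {VD : FrdICatStub.{u, v, w} D} (S : BiKummerSetting X T D VD)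

namespace Prop42Sub

variable (pullFrac : ∀ {A A' : S.C} (_ : A' ⟶ A), S.biratUnits A → S.biratUnits A')

/-! ## §1. Law-free model-Frobenioid bookkeeping -/

/-- **A pull-back morphism of `C` is linear — law-free** ([FrdI] Thm. 5.2 (ii): test object
`(A_D, Base(φ)^* β)` with the morphism `(1, Base(φ), 0, 1)`; the tree's `degFr_div_of_isPullbackMorphism`
minus its sharpness step). [cite: MochizukiFrdI2008, Thm. 5.2(ii) p.101] -/
theorem degFr_eq_one_of_isPullback {A B : S.C} {φ : A ⟶ B} (h : S.IsPullback φ) :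
    ModelFrobenioid.degFr φ = 1 := by
  let f : A.base ⟶ B.base := ModelFrobenioid.baseMap φ
  let W : S.C := ⟨A.base, pullGp S.tf.divisorMonoid f B.cls⟩
  let δ : W ⟶ B := ModelFrobenioid.mkHom W B 1 f 1 1 (by
    show pullGp S.tf.divisorMonoid f B.cls ^ ((1 : ℕ+) : ℕ) * Algebra.GrothendieckGroup.of 1 =
      pullGp S.tf.divisorMonoid f B.cls * divB S.tf.divisorMonoid S.tf.ratFnFunctor S.tf.divBNatTrans (op A.base) 1
    rw [PNat.one_coe, pow_one, map_one, mul_one, map_one, mul_one])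
  obtain ⟨γ, hγ⟩ := (h W).2 ⟨(δ, 𝟙 A.base), show f = 𝟙 A.base ≫ f from (Category.id_comp _).symm⟩
  have e1 : γ ≫ φ = δ := congrArg (fun p : PreFrobenioid.PullbackHomData S.F φ W => p.1.1) hγ
  have hn : ModelFrobenioid.degFr φ * ModelFrobenioid.degFr γ = 1 := congrArg ModelFrobenioid.Hom.degFr e1
  exact pnat_eq_one_of_mul_eq_one hn

/-- **`Div(α') = 0` for the pull-back part of data of base-Frobenius type of an ISOMETRY `α`** (Def. 4.1
(iv): `α = α'' ≫ α'` with `α''` base-identity of Frobenius type, hence an isometry; [FrdI] Thm. 5.2 (i):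
`Div(α) = Base(α'')^* Div(α') · Div(α'')^{deg_Fr α'}`) — law-free. [cite: MochizukiEtTh2009, Def 4.1 p.87] -/
theorem div_α₁_eq_one {A B : S.C} {α : A ⟶ B} (d : S.BaseFrobeniusTypeData α) (hα : S.IsIsometry α) :
    ModelFrobenioid.div d.α₁ = 1 := by
  have h₂b : ModelFrobenioid.baseMap d.α₂ = 𝟙 _ := d.cond_c.1
  have h₂d : ModelFrobenioid.div d.α₂ = 1 := d.cond_c.2.1.2
  have e := congrArg ModelFrobenioid.div d.fac
  rw [ModelFrobenioid.div_comp_pull, h₂b, h₂d, one_pow, mul_one, pull_id] at e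
  exact e.trans hα

/-- A morphism `ζ` with `ζ ≫ φ' = φ` for two LINEAR morphisms `φ, φ'` with `Div = 0` is linear with
`Div = 0` — law-free form of abc-iut-w4-d044's `degFr_div_of_comp_pullback`.
[cite: MochizukiFrdI2008, Thm. 5.2(ii) p.101] -/
theorem degFr_div_of_comp_eq {A A' B : S.C} {φ : A ⟶ B} {φ' : A' ⟶ B} {ζ : A ⟶ A'}
    (hn : ModelFrobenioid.degFr φ = 1) (hd : ModelFrobenioid.div φ = 1)
    (hn' : ModelFrobenioid.degFr φ' = 1) (hd' : ModelFrobenioid.div φ' = 1) (h : ζ ≫ φ' = φ) :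
    ModelFrobenioid.degFr ζ = 1 ∧ ModelFrobenioid.div ζ = 1 := by
  have e1 : ModelFrobenioid.degFr φ' * ModelFrobenioid.degFr ζ = ModelFrobenioid.degFr φ := by
    rw [← ModelFrobenioid.degFr_comp, h]
  have e2 : pull S.tf.divisorMonoid (ModelFrobenioid.baseMap ζ) (ModelFrobenioid.div φ') *
      ModelFrobenioid.div ζ ^ (ModelFrobenioid.degFr φ' : ℕ) = ModelFrobenioid.div φ := by
    rw [← ModelFrobenioid.div_comp_pull, h]
  rw [hn', one_mul, hn] at e1
  rw [hd', map_one, one_mul, hn', PNat.one_coe, pow_one, hd] at e2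
  exact ⟨e1, e2⟩

/-- For base-identity isometries `φ, φ'` of `A` and an isomorphism `x` with `φ ≫ x = φ'`: `Div(x) = 0` and
`Div(x⁻¹) = 0` — law-free. [cite: MochizukiFrdI2008, Thm. 5.2(ii) p.101] -/
theorem div_iso_eq_one_of_comp_eq {A : S.C} {φ φ' : A ⟶ A} (x : A ≅ A)
    (hb : ModelFrobenioid.baseMap φ = 𝟙 _) (hd : ModelFrobenioid.div φ = 1)
    (hd' : ModelFrobenioid.div φ' = 1) (hx : φ ≫ x.hom = φ') :
    ModelFrobenioid.div x.hom = 1 ∧ ModelFrobenioid.div x.inv = 1 := by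
  have hx1 : ModelFrobenioid.degFr x.hom = 1 := ModelFrobenioid.degFr_eq_one_of_isIso x.hom
  have e := congrArg ModelFrobenioid.div hx
  rw [ModelFrobenioid.div_comp_pull, hb, pull_id, hx1, PNat.one_coe, pow_one, hd, mul_one,
    hd'] at e
  refine ⟨e, ?_⟩
  have hi1 : ModelFrobenioid.degFr x.inv = 1 := ModelFrobenioid.degFr_eq_one_of_isIso x.inv
  have e' := congrArg ModelFrobenioid.div x.hom_inv_id
  rw [ModelFrobenioid.div_comp_pull, hi1, PNat.one_coe, pow_one, e, mul_one, ModelFrobenioid.div_id] at e'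
  haveI : IsIso (ModelFrobenioid.baseMap x.hom) := ModelFrobenioid.isIso_baseMap_of_isIso x.hom
  exact PreFrobenioid.pull_injective (ModelFrobenioid.baseMap x.hom) (e'.trans (map_one _).symm)

/-! ## §2. L06 `ZetaA` from L05 `UnitRootsUpstairs`, law-free -/

/-- **(iv)/L06 `ZetaA` ⇐ L05 `UnitRootsUpstairs` — for EVERY setting** whose Def. 4.1 (iv)(e) predicate
implies the canonical reading `TemperedFrobenioid.ArisesFromBaseFrobenioid` (a base-Frobenius pair `(P, F)` of
`C`, [FrdI] Def. 2.7, with `α'` `P`-distinguished and `α''` `F`-distinguished), with NO structural law: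
given two `N`-th roots of the same fraction-pair and a base isomorphism `Ā' : A_N^bs ⥲ Ā_N^bs` with
`ᾱ^bs ∘ Ā' = α^bs`, there is `ζ_A : A_N ⥲ Ā_N` with `ᾱ ∘ ζ_A = α` and `ζ_A^bs = Ā'`.  abc-iut-w4-d044's
proof (module docstring of `Sec4Prop42SubZetaA.lean`) with the three law-free bookkeeping lemmas of §1.
[cite: MochizukiEtTh2009, Prop 4.2 p.90] -/
theorem zetaA_of_unitRootsUpstairs_lawFree
    (hE : ∀ {A B : S.C} (G : Subgroup (Aut A)) (α₂ : A ⟶ A) (α₁ : A ⟶ B),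
      S.ArisesFromBaseFrobeniusPair G α₂ α₁ → S.tf.ArisesFromBaseFrobeniusPair G α₂ α₁)
    (h₅ : UnitRootsUpstairs S pullFrac) :
    Literature.AnabelianGeometry.EtaleTheta.BiKummerSetting.Prop42Sub.ZetaA (VD := VD) S pullFrac := by
  have hBg : Objectwise (fun M _ => IsGroupLike M) S.tf.ratFnFunctor :=
    S.tf.isGroupLike_ratFnFunctor T.isUnit_BΛ
  intro B f P N R R' ebs hebs
  -- the two base-Frobenius pairs `(P, F)`, `(P̄, F̄)` of `C` (Def. 4.1 (iv)(e), canonical reading) and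
  -- the Frobenius endomorphisms `φo = F(n)_{A_⊙}`, `φo' = F̄(n̄)_{A_⊙}`: `α = α' ≫ φo`, `ᾱ = ᾱ' ≫ φo'`
  obtain ⟨Pr, Fr, hPF, -, hα₁, hα₂⟩ := hE _ _ _ R.αData.cond_e
  obtain ⟨Pr', Fr', hPF', -, hα₁', hα₂'⟩ := hE _ _ _ R'.αData.cond_e
  obtain ⟨φo, hnat, hbo, hdo⟩ := exists_comp_frobenius_of_distinguished S hPF hα₁ hα₂
  obtain ⟨φo', hnat', hbo', hdo'⟩ := exists_comp_frobenius_of_distinguished S hPF' hα₁' hα₂'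
  rw [R.αData.fac] at hnat
  rw [R'.αData.fac] at hnat'
  -- `α'`, `ᾱ'` are linear (pull-back morphisms) with `Div = 0` (`α, ᾱ` isometries) — law-free
  have hp₁ : ModelFrobenioid.degFr R.αData.α₁ = 1 ∧ ModelFrobenioid.div R.αData.α₁ = 1 :=
    ⟨degFr_eq_one_of_isPullback S R.αData.cond_d, div_α₁_eq_one S R.αData R.isIsometry.1⟩
  have hp₁' : ModelFrobenioid.degFr R'.αData.α₁ = 1 ∧ ModelFrobenioid.div R'.αData.α₁ = 1 :=
    ⟨degFr_eq_one_of_isPullback S R'.αData.cond_d, div_α₁_eq_one S R'.αData R'.isIsometry.1⟩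
  have hN : ModelFrobenioid.degFr R.α = N := R.isIsometry.2.2.1
  have hN' : ModelFrobenioid.degFr R'.α = N := R'.isIsometry.2.2.1
  have hdego : ModelFrobenioid.degFr φo = N := by
    have h := congrArg ModelFrobenioid.degFr hnat
    rw [ModelFrobenioid.degFr_comp, hp₁.1, mul_one, hN] at h
    exact h
  have hdego' : ModelFrobenioid.degFr φo' = N := by
    have h := congrArg ModelFrobenioid.degFr hnat'
    rw [ModelFrobenioid.degFr_comp, hp₁'.1, mul_one, hN'] at h
    exact h
  -- hence they differ by a unit `x ∈ O^×(A_⊙)`: `φo' = φo ≫ x` ([FrdI] Def. 1.3 (ii) for the model)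
  haveI : IsIso (ModelFrobenioid.baseMap φo) := by rw [hbo]; infer_instance
  haveI : IsIso (ModelFrobenioid.baseMap φo') := by rw [hbo']; infer_instance
  obtain ⟨x, hx⟩ := ModelFrobenioid.exists_iso_comp_eq_of_div_eq hBg φo φo'
    (hdego.trans hdego'.symm) (hdo.trans hdo'.symm)
  have hxb : ModelFrobenioid.baseMap x.hom = 𝟙 _ := by
    have h := congrArg ModelFrobenioid.baseMap hx
    rw [ModelFrobenioid.baseMap_comp, hbo, hbo', Category.id_comp] at h
    exact h
  have hxd : ModelFrobenioid.div x.hom = 1 ∧ ModelFrobenioid.div x.inv = 1 :=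
    div_iso_eq_one_of_comp_eq S x hbo hdo hdo' hx
  have hxu : x ∈ S.units S.Aodot := ⟨hxb, ModelFrobenioid.degFr_eq_one_of_isIso x.hom⟩
  have hxsu : x.symm ∈ S.units S.Aodot := by
    have h := (S.units S.Aodot).inv_mem hxu
    rwa [Aut.Aut_inv_def] at h
  have hxib : ModelFrobenioid.baseMap x.inv = 𝟙 _ := hxsu.1
  -- `Base(α) = Base(α')`, `Base(ᾱ) = Base(ᾱ')`
  have hbα : ModelFrobenioid.baseMap R.α = ModelFrobenioid.baseMap R.αData.α₁ :=
    baseMap_eq_baseMap_α₁ S R.αData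
  have hbα' : ModelFrobenioid.baseMap R'.α = ModelFrobenioid.baseMap R'.αData.α₁ :=
    baseMap_eq_baseMap_α₁ S R'.αData
  -- the lift `ζ₀ : A_N → Ā_N` of `Ā'` with `ζ₀ ≫ ᾱ' = α'` (pull-back property of `ᾱ'`), an isomorphism
  have hpb : PreFrobenioid.Base S.F R.αData.α₁ = ebs.hom ≫ PreFrobenioid.Base S.F R'.αData.α₁ := by
    change ModelFrobenioid.baseMap R.αData.α₁ = ebs.hom ≫ ModelFrobenioid.baseMap R'.αData.α₁
    rw [← hbα, ← hbα']
    exact hebs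
  obtain ⟨ζ₀, hζ₀⟩ := (R'.αData.cond_d R.AN).2 ⟨(R.αData.α₁, ebs.hom), hpb⟩
  have e1 : ζ₀ ≫ R'.αData.α₁ = R.αData.α₁ :=
    congrArg (fun p : PreFrobenioid.PullbackHomData S.F R'.αData.α₁ R.AN => p.1.1) hζ₀
  have e2 : ModelFrobenioid.baseMap ζ₀ = ebs.hom :=
    congrArg (fun p : PreFrobenioid.PullbackHomData S.F R'.αData.α₁ R.AN => p.1.2) hζ₀
  have hζ₀nd := degFr_div_of_comp_eq S hp₁.1 hp₁.2 hp₁'.1 hp₁'.2 e1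
  haveI : IsIso (ModelFrobenioid.baseMap ζ₀) := by rw [e2]; infer_instance
  haveI : IsIso ζ₀ := ModelFrobenioid.isIso_of hBg ζ₀ hζ₀nd.2 hζ₀nd.1
  -- the unit `y` of `A_N` over `x⁻¹` along `α'` (pull-back property of `α'`)
  have hpb₂ : PreFrobenioid.Base S.F (R.αData.α₁ ≫ x.inv) =
      𝟙 _ ≫ PreFrobenioid.Base S.F R.αData.α₁ := by
    change ModelFrobenioid.baseMap (R.αData.α₁ ≫ x.inv) = 𝟙 _ ≫ ModelFrobenioid.baseMap R.αData.α₁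
    rw [ModelFrobenioid.baseMap_comp, hxib, Category.comp_id, Category.id_comp]
  obtain ⟨y, hy⟩ := (R.αData.cond_d R.AN).2 ⟨(R.αData.α₁ ≫ x.inv, 𝟙 _), hpb₂⟩
  have e3 : y ≫ R.αData.α₁ = R.αData.α₁ ≫ x.inv :=
    congrArg (fun p : PreFrobenioid.PullbackHomData S.F R.αData.α₁ R.AN => p.1.1) hy
  have e4 : ModelFrobenioid.baseMap y = 𝟙 _ :=
    congrArg (fun p : PreFrobenioid.PullbackHomData S.F R.αData.α₁ R.AN => p.1.2) hy
  have hynd : ModelFrobenioid.degFr y = 1 ∧ ModelFrobenioid.div y = 1 := by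
    have h1 : ModelFrobenioid.degFr (y ≫ R.αData.α₁) = ModelFrobenioid.degFr (R.αData.α₁ ≫ x.inv) := by
      rw [e3]
    have h2 : ModelFrobenioid.div (y ≫ R.αData.α₁) = ModelFrobenioid.div (R.αData.α₁ ≫ x.inv) := by
      rw [e3]
    have hdx : ModelFrobenioid.degFr (R.αData.α₁ ≫ x.inv) = ModelFrobenioid.degFr R.αData.α₁ := by
      rw [ModelFrobenioid.degFr_comp, ModelFrobenioid.degFr_eq_one_of_isIso x.inv, one_mul]
    have hvx : ModelFrobenioid.div (R.αData.α₁ ≫ x.inv) = ModelFrobenioid.div R.αData.α₁ := by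
      rw [ModelFrobenioid.div_comp_pull, hxd.2, map_one, one_mul, ModelFrobenioid.degFr_eq_one_of_isIso x.inv,
        PNat.one_coe, pow_one]
    rw [ModelFrobenioid.degFr_comp, hdx, hp₁.1, one_mul] at h1
    rw [ModelFrobenioid.div_comp_pull, hvx, hp₁.2, map_one, one_mul, hp₁.1, PNat.one_coe, pow_one] at h2
    exact ⟨h1, h2⟩
  haveI : IsIso (ModelFrobenioid.baseMap y) := by rw [e4]; infer_instance
  haveI : IsIso y := ModelFrobenioid.isIso_of hBg y hynd.2 hynd.1
  have hyu : asIso y ∈ S.units R.AN := ⟨e4, hynd.1⟩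
  -- L05: `y = tᴺ` for a unit `t` of `A_N`
  have hover : (asIso y).hom ≫ R.αData.α₁ = R.αData.α₁ ≫ x.symm.hom := e3
  obtain ⟨t, htu, htN⟩ := h₅ f P N R x.symm (asIso y) hxsu hyu hover
  have htb : ModelFrobenioid.baseMap t.hom = 𝟙 _ := htu.1
  -- Frobenius-normalization of `A_N`: `t ≫ α'' = α'' ≫ tᴺ = α'' ≫ y`
  have hdeg₂ : ModelFrobenioid.degFr R.αData.α₂ = N := by
    have h := congrArg ModelFrobenioid.degFr R.αData.fac
    rw [ModelFrobenioid.degFr_comp, hp₁.1, one_mul, hN] at h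
    exact h
  have hnorm : t.hom ≫ R.αData.α₂ = R.αData.α₂ ≫ y := by
    have h := PreFrobenioid.unit_comp_eq_comp_pow S.F (ModelFrobenioid.isFrobeniusNormalized R.AN)
      R.αData.cond_c.1 htu
    have hd : (PreFrobenioid.degFr S.F R.αData.α₂ : ℕ) = N := congrArg PNat.val hdeg₂
    rw [hd, htN] at h
    exact h
  -- `ζ_A := t ≫ ζ₀`
  refine ⟨t ≪≫ asIso ζ₀, ?_, ?_⟩
  · calc (t ≪≫ asIso ζ₀).hom ≫ R'.α = t.hom ≫ ζ₀ ≫ R'.αData.α₁ ≫ φo' := by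
          rw [Iso.trans_hom, asIso_hom, Category.assoc, hnat']
      _ = t.hom ≫ R.αData.α₁ ≫ φo ≫ x.hom := by rw [reassoc_of% e1, ← hx]
      _ = t.hom ≫ R.αData.α₂ ≫ R.αData.α₁ ≫ x.hom := by
          rw [reassoc_of% hnat, reassoc_of% R.αData.fac]
      _ = R.αData.α₂ ≫ R.αData.α₁ ≫ x.inv ≫ x.hom := by rw [reassoc_of% hnorm, reassoc_of% e3]
      _ = R.α := by rw [Iso.inv_hom_id, Category.comp_id, R.αData.fac]
  · ext
    change ModelFrobenioid.baseMap (t.hom ≫ ζ₀) = ebs.hom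
    rw [ModelFrobenioid.baseMap_comp, e2, htb, Category.id_comp]

/-! ## §3. Prop. 4.2 (iv) AS TYPED ⇐ L05 + `hE`, for every setting, no law -/

/-- **[EtTh] Prop. 4.2 (iv) AS TYPED ⇐ L05 `UnitRootsUpstairs` + the Def. 4.1 (iv)(e) reading `hE` —
for EVERY setting (every [FrdI] vocabulary) and every transport, with NO structural law and no birational
dictionary**: L06 by `zetaA_of_unitRootsUpstairs_lawFree`, L07/L08 by `prop42_iv_of_zetaA_lawFree`
(abc-iut-f-084 p436714 with abc-iut-f-131's `betaCompat_holds` / `rootUnitTorsion_holds`).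
[cite: MochizukiEtTh2009, Prop 4.2 p.89] -/
theorem prop42_iv_of_unitRootsUpstairs_lawFree
    (hE : ∀ {A B : S.C} (G : Subgroup (Aut A)) (α₂ : A ⟶ A) (α₁ : A ⟶ B),
      S.ArisesFromBaseFrobeniusPair G α₂ α₁ → S.tf.ArisesFromBaseFrobeniusPair G α₂ α₁)
    (h₅ : UnitRootsUpstairs S pullFrac) :
    Literature.AnabelianGeometry.EtaleTheta.BiKummerSetting.Prop42_iv S pullFrac :=
  prop42_iv_of_zetaA_lawFree S pullFrac (zetaA_of_unitRootsUpstairs_lawFree S pullFrac hE h₅)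

end Prop42Sub

/-! ## §4. The canonical model instance `mkOfModelCanonical`: (iv) modulo L05 alone, no law -/

section Canonical

variable (X) (tf : TemperedFrobenioid T D VD) (hZ : tf.monoidType = MonoidType.Z)
  (hP : ∀ A : Dᵒᵖ, IsPerfect (tf.Φ.carrier A)) (IG : D → Prop) (gS : ∀ A : D, IG A → (X.Pi →* Aut A))
  (gSs : ∀ (A : D) (h : IG A), Function.Surjective (gS A h))
  (NH : Subgroup (Field.absoluteGaloisGroup K) → tf.category → ℕ+ → Prop) (A₀ : tf.category)
  (hA₀ : PreFrobenioid.IsFrobeniusTrivial tf.toElem A₀) (hA₀' : IG A₀.base)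

/-- **L06 `ZetaA` for the CANONICAL MODEL INSTANCE ⇐ L05 at that instance, NO law** (abc-iut-L2-t9's
`mkOfModelCanonical`: `hE` is definitional). [cite: MochizukiEtTh2009, Prop 4.2 p.90] -/
theorem zetaA_mkOfModelCanonical_of_unitRootsUpstairs_lawFree
    (h₅ : Prop42Sub.UnitRootsUpstairs (mkOfModelCanonical X tf hZ hP IG gS gSs NH A₀ hA₀ hA₀')
      (fun φ x => tf.pullFracModel φ x)) :
    Prop42Sub.ZetaA (mkOfModelCanonical X tf hZ hP IG gS gSs NH A₀ hA₀ hA₀')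
      (fun φ x => tf.pullFracModel φ x) :=
  Prop42Sub.zetaA_of_unitRootsUpstairs_lawFree (mkOfModelCanonical X tf hZ hP IG gS gSs NH A₀ hA₀ hA₀')
    (fun φ x => tf.pullFracModel φ x) (fun _ _ _ h => h) h₅

/-- **[EtTh] Prop. 4.2 (iv) AS TYPED for the CANONICAL MODEL INSTANCE, modulo the single sub-node L05 and
NOTHING ELSE** (no «`Φ` divisorial», no dictionary): the residual law of abc-iut-w4-d044's
`prop42_iv_mkOfModelCanonical_of_unitRootsUpstairs` is gone. [cite: MochizukiEtTh2009, Prop 4.2 p.89] -/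
theorem prop42_iv_mkOfModelCanonical_of_unitRootsUpstairs_lawFree
    (h₅ : Prop42Sub.UnitRootsUpstairs (mkOfModelCanonical X tf hZ hP IG gS gSs NH A₀ hA₀ hA₀')
      (fun φ x => tf.pullFracModel φ x)) :
    (mkOfModelCanonical X tf hZ hP IG gS gSs NH A₀ hA₀ hA₀').Prop42_iv (fun φ x => tf.pullFracModel φ x) :=
  Prop42Sub.prop42_iv_of_unitRootsUpstairs_lawFree (mkOfModelCanonical X tf hZ hP IG gS gSs NH A₀ hA₀ hA₀')
    (fun φ x => tf.pullFracModel φ x) (fun _ _ _ h => h) h₅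

end Canonical

end BiKummerSetting

end Literature.AnabelianGeometry.EtaleTheta
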